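import Literature.MathematicalPhysics.QuantumFieldTheory.Balaban1983to89.Beta.DecimatedMomentSummable

/-!
# `BalabanUV.Beta.FP.MultiplierVertexMoment` — road «FP» (binder row D1), remainder `ρ_n` of the H′ bookkeeping, row **RHOA-7** «THE MULTIPLIER
# VERTEX»: a loop one of whose external legs is a coarse EQUATION-OF-MOTION kernel (zero mass, zero first moments) has coarse second moment
# `M₂(e.o.m. leg) × (ZEROTH moment of the inner kernel)`; with the e.o.m. on BOTH external legs the second moment is ZERO
# ([folklore] lattice bookkeeping on `ℤ^d` over b12's nine-term master identity at window `N = 1`; abstract kernels, every letter displayed)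

HONEST DEPENDENCY (page 1, mandatory): continuum YM on T⁴ ⇐ BetaPertH ∧ nine spine estimates (0/9 proved); BetaPertH ⇐ (D1) ∧ (D4) ∧
CAP+tail; G-an2-4 gates asym, D1 and NE2/3/4.  HONEST FRAMING (cell contract, verbatim): «discharging `BetaPertH` makes Bałaban's UV
stability UNCONDITIONAL — a real constructive-QFT result; it is NOT the continuum limit and NOT the Clay problem.»  THIS MODULE is elementary
[folklore] bookkeeping of unconditional sums on `ℤ^d`, composed BY NAME from b12's `Beta.DecimatedMomentSummable` (`dressedSum`, the nine-term
master identity `hasSum_term_second`, `hasSum_coarse`, `AbsMoment₂`, `monoSummable_of_absMoment₂`, `summable_dressed_fibre`), an2's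
`DecimatedMoment.cosetInd_one` and `B12Beta.secondMoment` (the evenness lemma is the real-multiplication twin of leaf-02's
`FP/HorizontalBookkeeping.tsum_coord_smul_eq_zero_of_even`, re-derived in eight lines to keep the import cone at b12's file); it asserts nothing
about Bałaban's objects, cites nothing, mints no `Prop` fact, has no `def`, 0 sorry.  NOT `Mix_n = O(1)`, NOT `hbook`, NOT D1, NOT BetaPertH, NOT
continuum, NOT Clay.

ABSOLUTE RULE (cell charter, verbatim): «No internally-minted statement may enter as a cited fact. Every hypothesis is either kernel-proved in
this package or a verbatim quotation of a PUBLISHED theorem with page reference. The manuscript(s) under audit are NOT citable for their own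
disputed steps — they are the thing under adjudication; programme-internal (2001/route/tribunal) claims are never citable.»

ROW (owner b2b-balaban-beta-d1-p3, `RHOA-DESIGN.md` v1.1 §1 S3 + §5, `LEAVES-FP.md` «RHOA-7 (MULTIPLIER, S after RHOA-1)»; orientation only,
nothing of it asserted).  S3: «THE MULTIPLIER VERTEX IS THE COARSE EQUATION OF MOTION: `η̇ := dη/dV|₀ = n⁻⁴·Δ_∞^c` (S1 + stationarity
`Δ₁Ḃ = Qᵀη̇`, `QḂ = V̇`), so every loop containing the vertex `η̇[V̇]·D²Q_B(𝟙)` carries one external factor `Δ_∞V̇` (p² on one leg): … its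
coarse-lattice second moment is a FINITE, n-uniformly bounded number once the loop's other letters are n-uniform (it cannot touch the slope).»
§5: «the loop's contribution to `secondMoment` is `Σ_v k(v)v²` of a kernel `k = Δ^c ∘ (bounded, n-uniformly summable)` ⟹ equals `−2·Σ(…)` of the
inner kernel's ZEROTH moment — finite, n-uniform given RHOA-6-type letters; displayed constant.»  The MODEL letter of S3 is already the tree's
`Beta.CompositionSingular.mul_minOp_eq` («`H·ℋ = Qᵀ·𝒮` (Euler–Lagrange)»: the Lagrange multiplier of the constrained minimiser `ℋa` IS
`𝒮a = effForm H Q · a`, whence `η̇ = 𝔊 := effForm(H_cov, Q)`); the identification `𝔊 = n⁻⁴Δ_∞^c` is S1∕S2 (RHOA-1a `FP/SliceSaturation` ✓ + the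
road instance GAMMA-1) — neither is restated here.  THIS FILE is the lattice half: what an e.o.m. leg does to a coarse second moment.

ABSTRACT CURRENCY.  Kernels are real functions on `ℤ^d` (`Fin d → ℤ`); the e.o.m. leg is `G` (scalar) or `G μ λ` (direction-indexed), the inner
kernel of the loop is `g` (scalar) or `g : B12Beta.Kernel d`; the loop's coarse kernel in the two background insertions is the ONE-SIDED LATTICE
CONVOLUTION `y ↦ Σ'_x G (y − x)·g x` (written INLINE, no `def`), which §1 identifies with b12's two-sided `dressedSum w T w' y =
Σ'_{(u,x)} w u·T (y + u − x)·w' x` at the Kronecker left pattern `w = Pi.single 0 1`.  The only analytic letter is `AbsMoment₂ f`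
(`Σ_y (1 + |y|₁²)·|f y| < ∞`) for each factor; (T0) `Σ' G = 0` (zero mass) and (T1) `Σ'_t G t·t_κ = 0` (zero first moments; from EVENNESS,
§3) are the e.o.m. letters.  Moments are `tsum`s in the integrand order of `B12Beta.secondMoment` (`Σ'_t f t·t_κ·t_λ`).

CONTENT.
* §1 `hasSum_coord_smul` ∕ `hasSum_coord2_smul` (moment families from `AbsMoment₂`, `zsmul` form with real values), `absMoment₂_single`,
  `tsum_single_mul_coord(2)` (the Kronecker pattern has zero first∕second moments), **`dressedSum_single_left`**
  (`dressedSum (Pi.single 0 1) G g y = Σ'_x G (y − x)·g x`), `tsum_conv_comm` (`Σ'_x G(y−x)·g x = Σ'_x g(y−x)·G x`).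
* §2 **`hasSum_dressedSum_mul_coord2`** — THE NINE-TERM IDENTITY AT WINDOW `N = 1`: for `w, T, w'` with `AbsMoment₂`,
  `HasSum (y ↦ dressedSum w T w' y·y_κ·y_λ) (σ·m₂·n₀ + σ·m₁κ·n₁λ + σ·m₁λ·n₁κ − C_λ·m₁κ·n₀ − C_κ·m₁λ·n₀ + σ·m₀·n₂ − C_λ·m₀·n₁κ − C_κ·m₀·n₁λ + p₂·m₀·σ′)`
  with `σ, C, p₂` the zeroth∕first∕second moments of `w`, `m` of `T`, `n, σ′` of `w'`; and its one-sided case **`hasSum_conv_mul_coord2`** — THE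
  FOUR-TERM IDENTITY `M₂^{κλ}(G ∗ g) = M₂^{κλ}(G)·M₀(g) + M₁^κ(G)·M₁^λ(g) + M₁^λ(G)·M₁^κ(g) + M₀(G)·M₂^{κλ}(g)`.
* §3 THE MULTIPLIER CASE: **`hasSum_conv_mul_coord2_of_T0T1`** ((T0) + (T1) on the leg `G` ⟹ `HasSum (y ↦ (Σ'_x G(y−x)·g x)·y_κ·y_λ)
  (M₂^{κλ}(G)·Σ' g)` — «the loop's second moment is a ZEROTH moment of the inner kernel»), `tsum_mul_coord_eq_zero_of_even` ((T1) from
  evenness, involution `t ↦ −t`), `hasSum_conv_mul_coord2_of_even`, the `B12Beta.secondMoment` packagings `secondMoment_conv_of_T0T1` (scalar leg, `Kernel d`-valued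
  inner kernel) and `hasSum_mconv_mul_coord2_of_T0T1` ∕ `secondMoment_mconv_of_T0T1` (direction-indexed leg `k μ ν y = Σ_c Σ'_x G μ c (y−x)·g c ν x`:
  `secondMoment k μ ν = Σ_c M₂^{μν}(G μ c)·M₀(g c ν)`), the DISPLAYED constants `abs_tsum_le_absMoment₂`, `abs_tsum_mul_coord2_le_absMoment₂`,
  **`abs_secondMoment_conv_le_of_T0T1`** (`|secondMoment k μ ν| ≤ (Σ'(1+|y|₁²)|G|)·(Σ'(1+|x|₁²)|g μ ν|)` — n-free as soon as the two letters are),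
  and the located remark «(1.22) uses `μ ≠ ν`»: `tsum_mul_coord2_eq_zero_of_reflect` (a SCALAR leg even under the reflection of ONE coordinate
  `κ ≠ λ` has `M₂^{κλ} = 0`), whence `secondMoment_conv_eq_zero_of_reflect` — such a loop contributes NOTHING off the diagonal (for a
  direction-indexed leg the mixed blocks `G μ ν` survive through `Σ_c`, see `secondMoment_mconv_of_T0T1`; nothing more is claimed).
* §4 TWO e.o.m. LEGS: **`hasSum_dressedSum_mul_coord2_eq_zero`** ((T0) on `w` and `w'`, (T1) on `w` ⟹ `HasSum (y ↦ dressedSum w T w' y·y_κ·y_λ) 0`),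
  the mirror variant `…_eq_zero'` ((T1) on `w'` instead), `secondMoment_dressedSum_eq_zero`.
* §5 (v1.1, append-only) `abs_secondMoment_mconv_le_of_T0T1` — the displayed constant for the direction-indexed leg (`Σ_c` of the scalar one).
COMPANION (same row, independent imports): `FP/ConvolutionAbsMoment` — the convolution PRESERVES `AbsMoment₂` with the displayed constant
`2·(Σ'(1+|u|₁²)|G|)·(Σ'(1+|x|₁²)|g|)`, so the loop kernel of §3 is again a kernel of the class (composability).
Provenance: cross-cell idle-seat kernel duty NE7b → β∕D1, unit `b2b-balaban-t4-ne7b-formalise-leaf-10` gen 24 (prover-…-leaf-10-g24-0), 2026-08-21;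
journal INTENT ∕ CLAIM «RHOA-7» l.24534; «not in print; our bookkeeping»; no existing file touched.
-/

noncomputable section

namespace Summit.QuantumFields.BalabanUV.Beta.FP.MultiplierVertexMoment

open Finset Filter Topology
open scoped BigOperators
open Literature.MathematicalPhysics.QuantumFieldTheory.Balaban1983to89
open Literature.MathematicalPhysics.QuantumFieldTheory.Balaban1983to89.Beta
open DecimatedMoment (cosetInd cosetInd_one)
open DecimatedMomentLimit (abs_cosetInd_le_one)
open DecimatedMomentSummable (IsMoment₂ dressedSum AbsMoment₂ hasSum_term_second hasSum_coarse monoSummable_of_absMoment₂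
  summable_smul_of_absMoment₂ summable_of_absMoment₂ summable_dressed_fibre abs_le_of_isMoment₂)
open B12Sec2to5 (l1 l1_nonneg)

variable {d : ℕ}

/-! ## §1 Moment families; the Kronecker pattern; the one-sided convolution as a dressed sum -/

/-- [folklore] The first-moment family of a kernel with `AbsMoment₂`, in `zsmul` form, HAS the sum `Σ'_t f t·t_κ`. -/
theorem hasSum_coord_smul {f : (Fin d → ℤ) → ℝ} (hf : AbsMoment₂ f) (κ : Fin d) :
    HasSum (fun t : Fin d → ℤ => t κ • f t) (∑' t, f t * (t κ : ℝ)) := by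
  have hs := summable_smul_of_absMoment₂ hf (IsMoment₂.coord κ)
  have e : ∀ t : Fin d → ℤ, t κ • f t = f t * (t κ : ℝ) := fun t => by rw [zsmul_eq_mul, mul_comm]
  rw [show (∑' t, f t * (t κ : ℝ)) = ∑' t : Fin d → ℤ, t κ • f t from tsum_congr (fun t => (e t).symm)]
  exact hs.hasSum

/-- [folklore] The second-moment family of a kernel with `AbsMoment₂`, in `zsmul` form, HAS the sum `Σ'_t f t·t_κ·t_λ`. -/
theorem hasSum_coord2_smul {f : (Fin d → ℤ) → ℝ} (hf : AbsMoment₂ f) (κ l : Fin d) :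
    HasSum (fun t : Fin d → ℤ => (t κ * t l) • f t) (∑' t, f t * (t κ : ℝ) * (t l : ℝ)) := by
  have hs := summable_smul_of_absMoment₂ hf (IsMoment₂.coord2 κ l)
  have e : ∀ t : Fin d → ℤ, (t κ * t l) • f t = f t * (t κ : ℝ) * (t l : ℝ) := fun t => by
    rw [zsmul_eq_mul, Int.cast_mul]; ring
  rw [show (∑' t, f t * (t κ : ℝ) * (t l : ℝ)) = ∑' t : Fin d → ℤ, (t κ * t l) • f t from
    tsum_congr (fun t => (e t).symm)]
  exact hs.hasSum

/-- [folklore] The Kronecker pattern `Pi.single 0 1` has an absolutely summable second moment. -/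
theorem absMoment₂_single : AbsMoment₂ (Pi.single (0 : Fin d → ℤ) (1 : ℝ)) := by
  refine summable_of_ne_finset_zero (s := ({0} : Finset (Fin d → ℤ))) (fun u hu => ?_)
  rw [Finset.mem_singleton] at hu
  rw [Pi.single_apply, if_neg hu, abs_zero, mul_zero]

/-- [folklore] The Kronecker pattern has vanishing first moments. -/
theorem tsum_single_mul_coord (κ : Fin d) :
    ∑' u : Fin d → ℤ, (Pi.single (0 : Fin d → ℤ) (1 : ℝ) : (Fin d → ℤ) → ℝ) u * (u κ : ℝ) = 0 := by
  have e : (fun u : Fin d → ℤ => (Pi.single (0 : Fin d → ℤ) (1 : ℝ) : (Fin d → ℤ) → ℝ) u * (u κ : ℝ)) = fun _ => 0 := by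
    funext u
    by_cases hu : u = 0
    · subst hu; simp
    · rw [Pi.single_apply, if_neg hu, zero_mul]
  rw [e, tsum_zero]

/-- [folklore] The Kronecker pattern has vanishing second moments. -/
theorem tsum_single_mul_coord2 (κ l : Fin d) :
    ∑' u : Fin d → ℤ, (Pi.single (0 : Fin d → ℤ) (1 : ℝ) : (Fin d → ℤ) → ℝ) u * (u κ : ℝ) * (u l : ℝ) = 0 := by
  have e : (fun u : Fin d → ℤ => (Pi.single (0 : Fin d → ℤ) (1 : ℝ) : (Fin d → ℤ) → ℝ) u * (u κ : ℝ) * (u l : ℝ)) = fun _ => 0 := by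
    funext u
    by_cases hu : u = 0
    · subst hu; simp
    · rw [Pi.single_apply, if_neg hu, zero_mul, zero_mul]
  rw [e, tsum_zero]

/-- [folklore] **THE ONE-SIDED LATTICE CONVOLUTION IS b12's DRESSED SUM WITH THE KRONECKER LEFT PATTERN**:
`dressedSum (Pi.single 0 1) G g y = Σ'_x G (y − x)·g x` (no summability needed: the product family is supported on `{0} × ℤ^d`). -/
theorem dressedSum_single_left (G g : (Fin d → ℤ) → ℝ) (y : Fin d → ℤ) :
    dressedSum (Pi.single (0 : Fin d → ℤ) (1 : ℝ)) G g y = ∑' x, G (y - x) * g x := by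
  unfold dressedSum
  have hi : Function.Injective (fun x : Fin d → ℤ => ((0 : Fin d → ℤ), x)) := fun a b h => congrArg Prod.snd h
  have hsupp : Function.support (fun p : (Fin d → ℤ) × (Fin d → ℤ) =>
      (Pi.single (0 : Fin d → ℤ) (1 : ℝ) : (Fin d → ℤ) → ℝ) p.1 * G (y + p.1 - p.2) * g p.2) ⊆ Set.range (fun x : Fin d → ℤ => ((0 : Fin d → ℤ), x)) := by
    intro p hp
    rw [Function.mem_support] at hp
    have h1 : p.1 = 0 := by
      by_contra h
      exact hp (by rw [Pi.single_apply, if_neg h, zero_mul, zero_mul])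
    exact ⟨p.2, Prod.ext h1.symm rfl⟩
  rw [← hi.tsum_eq hsupp]
  refine tsum_congr (fun x => ?_)
  simp only [Pi.single_eq_same, one_mul, add_zero]

/-- [folklore] Commutativity of the lattice convolution (reindex by the involution `x ↦ y − x`). -/
theorem tsum_conv_comm (G g : (Fin d → ℤ) → ℝ) (y : Fin d → ℤ) :
    ∑' x, G (y - x) * g x = ∑' x, g (y - x) * G x := by
  rw [← Equiv.tsum_eq (Equiv.subLeft y) (fun x => g (y - x) * G x)]
  refine tsum_congr (fun x => ?_)
  simp only [Equiv.subLeft_apply, sub_sub_cancel, mul_comm]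

/-! ## §2 The nine-term identity at window `N = 1` and the four-term identity for the one-sided convolution -/

/-- [folklore] **THE SECOND MOMENT OF A TWO-SIDED COMPOSITION — b12's NINE-TERM MASTER IDENTITY AT WINDOW `N = 1`.**  For
`w, T, w' : ℤ^d → ℝ` with absolutely summable second moments, the coarse family `y ↦ dressedSum w T w' y·y_κ·y_λ` HAS the nine-term sum with
`σ = Σ' w`, `C_μ = Σ'_u w u·u_μ`, `p₂ = Σ'_u w u·u_κ·u_λ`, the moments `m₀, m₁, m₂` of `T`, `n₀ = σ′ = Σ' w'`, `n₁, n₂` of `w'`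
(`DecimatedMomentSummable.hasSum_term_second` with the trivial window `cosetInd 1 = 1`, regrouped by `hasSum_coarse`). -/
theorem hasSum_dressedSum_mul_coord2 (w T w' : (Fin d → ℤ) → ℝ) (hw : AbsMoment₂ w) (hT : AbsMoment₂ T) (hw' : AbsMoment₂ w')
    (κ l : Fin d) :
    HasSum (fun y : Fin d → ℤ => dressedSum w T w' y * (y κ : ℝ) * (y l : ℝ))
      ((∑' u, w u) * (∑' t, T t * (t κ : ℝ) * (t l : ℝ)) * (∑' x, w' x)
        + (∑' u, w u) * (∑' t, T t * (t κ : ℝ)) * (∑' x, w' x * (x l : ℝ))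
        + (∑' u, w u) * (∑' t, T t * (t l : ℝ)) * (∑' x, w' x * (x κ : ℝ))
        - (∑' u, w u * (u l : ℝ)) * (∑' t, T t * (t κ : ℝ)) * (∑' x, w' x)
        - (∑' u, w u * (u κ : ℝ)) * (∑' t, T t * (t l : ℝ)) * (∑' x, w' x)
        + (∑' u, w u) * (∑' t, T t) * (∑' x, w' x * (x κ : ℝ) * (x l : ℝ))
        - (∑' u, w u * (u l : ℝ)) * (∑' t, T t) * (∑' x, w' x * (x κ : ℝ))
        - (∑' u, w u * (u κ : ℝ)) * (∑' t, T t) * (∑' x, w' x * (x l : ℝ))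
        + (∑' u, w u * (u κ : ℝ) * (u l : ℝ)) * (∑' t, T t) * (∑' x, w' x)) := by
  set C : Fin d → ℝ := fun μ => ∑' u, w u * (u μ : ℝ) with hC
  have hL0 : ∀ a : Fin d → ℤ, HasSum (fun u => cosetInd 1 (a - u) • w u) (∑' u, w u) := fun a => by
    have e : (fun u => cosetInd 1 (a - u) • w u) = w := funext fun u => by rw [cosetInd_one, one_zsmul]
    rw [e]; exact (summable_of_absMoment₂ hw).hasSum
  have hL1 : ∀ (a : Fin d → ℤ) (μ : Fin d), HasSum (fun u => (cosetInd 1 (a - u) * u μ) • w u) (C μ) := fun a μ => by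
    have e : (fun u : Fin d → ℤ => (cosetInd 1 (a - u) * u μ) • w u) = fun u => u μ • w u :=
      funext fun u => by rw [cosetInd_one, one_mul]
    rw [e]; exact hasSum_coord_smul hw μ
  have hR0 : ∀ a : Fin d → ℤ, HasSum (fun x => cosetInd 1 (x - a) • w' x) (∑' x, w' x) := fun a => by
    have e : (fun x => cosetInd 1 (x - a) • w' x) = w' := funext fun x => by rw [cosetInd_one, one_zsmul]
    rw [e]; exact (summable_of_absMoment₂ hw').hasSum
  have A := hasSum_term_second (cosetInd 1) w T w' hL0 hL1 hR0 κ l (summable_of_absMoment₂ hT).hasSum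
    (hasSum_coord_smul hT κ) (hasSum_coord_smul hT l) (hasSum_coord2_smul hT κ l) (summable_of_absMoment₂ hw').hasSum
    (hasSum_coord_smul hw' κ) (hasSum_coord_smul hw' l) (hasSum_coord2_smul hw' κ l) (hasSum_coord2_smul hw κ l)
    (monoSummable_of_absMoment₂ (fun z => abs_cosetInd_le_one 1 z) hw hT hw')
  have B := hasSum_coarse (cosetInd 1) w T w' (fun y => y κ * y l) A (summable_dressed_fibre hw hT hw')
  have e1 : (fun y : Fin d → ℤ => (cosetInd 1 y * (y κ * y l)) • dressedSum w T w' y)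
      = fun y => dressedSum w T w' y * (y κ : ℝ) * (y l : ℝ) := by
    funext y
    rw [cosetInd_one, one_mul, zsmul_eq_mul, Int.cast_mul]
    ring
  rw [e1] at B
  exact B

/-- [folklore] **THE FOUR-TERM IDENTITY** for the one-sided convolution: `AbsMoment₂ G`, `AbsMoment₂ g` ⟹
`HasSum (y ↦ (Σ'_x G(y−x)·g x)·y_κ·y_λ) (M₂^{κλ}(G)·M₀(g) + M₁^κ(G)·M₁^λ(g) + M₁^λ(G)·M₁^κ(g) + M₀(G)·M₂^{κλ}(g))`
(the nine-term identity at the Kronecker left pattern: `σ = 1`, `C = 0`, `p₂ = 0`). -/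
theorem hasSum_conv_mul_coord2 (G g : (Fin d → ℤ) → ℝ) (hG : AbsMoment₂ G) (hg : AbsMoment₂ g) (κ l : Fin d) :
    HasSum (fun y : Fin d → ℤ => (∑' x, G (y - x) * g x) * (y κ : ℝ) * (y l : ℝ))
      ((∑' t, G t * (t κ : ℝ) * (t l : ℝ)) * (∑' x, g x)
        + (∑' t, G t * (t κ : ℝ)) * (∑' x, g x * (x l : ℝ))
        + (∑' t, G t * (t l : ℝ)) * (∑' x, g x * (x κ : ℝ))
        + (∑' t, G t) * (∑' x, g x * (x κ : ℝ) * (x l : ℝ))) := by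
  have h := hasSum_dressedSum_mul_coord2 (Pi.single (0 : Fin d → ℤ) (1 : ℝ)) G g absMoment₂_single hG hg κ l
  rw [tsum_pi_single, tsum_single_mul_coord κ, tsum_single_mul_coord l, tsum_single_mul_coord2 κ l] at h
  simp_rw [dressedSum_single_left] at h
  convert h using 1
  ring

/-! ## §3 The multiplier case: one external leg is an equation-of-motion kernel ((T0), (T1)) -/

/-- [folklore] **ONE e.o.m. LEG: THE LOOP's SECOND MOMENT IS `M₂(leg) × (ZEROTH MOMENT OF THE INNER KERNEL)`.**  (T0) `Σ' G = 0` and (T1)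
`Σ'_t G t·t_κ = 0 = Σ'_t G t·t_λ` ⟹ `HasSum (y ↦ (Σ'_x G(y−x)·g x)·y_κ·y_λ) (M₂^{κλ}(G)·Σ' g)`. -/
theorem hasSum_conv_mul_coord2_of_T0T1 (G g : (Fin d → ℤ) → ℝ) (hG : AbsMoment₂ G) (hg : AbsMoment₂ g) (κ l : Fin d)
    (h0 : ∑' t, G t = 0) (h1κ : ∑' t, G t * (t κ : ℝ) = 0) (h1l : ∑' t, G t * (t l : ℝ) = 0) :
    HasSum (fun y : Fin d → ℤ => (∑' x, G (y - x) * g x) * (y κ : ℝ) * (y l : ℝ))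
      ((∑' t, G t * (t κ : ℝ) * (t l : ℝ)) * (∑' x, g x)) := by
  have h := hasSum_conv_mul_coord2 G g hG hg κ l
  rw [h0, h1κ, h1l] at h
  simpa only [zero_mul, add_zero] using h

/-- [folklore] (T1) FROM EVENNESS: `G (−t) = G t` for all `t` ⟹ `Σ'_t G t·t_κ = 0` (the summand is odd under the involution `t ↦ −t`; no
summability needed; real-multiplication twin of leaf-02's `HorizontalBookkeeping.tsum_coord_smul_eq_zero_of_even`). -/
theorem tsum_mul_coord_eq_zero_of_even {G : (Fin d → ℤ) → ℝ} (heven : ∀ t, G (-t) = G t) (κ : Fin d) :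
    ∑' t, G t * (t κ : ℝ) = 0 := by
  have h1 : ∑' t : Fin d → ℤ, G (-t) * ((-t) κ : ℝ) = ∑' t : Fin d → ℤ, G t * (t κ : ℝ) :=
    (Equiv.neg (Fin d → ℤ)).tsum_eq (fun t => G t * (t κ : ℝ))
  have h2 : ∑' t : Fin d → ℤ, G (-t) * ((-t) κ : ℝ) = -∑' t : Fin d → ℤ, G t * (t κ : ℝ) := by
    rw [← tsum_neg]
    refine tsum_congr (fun t => ?_)
    rw [heven, Pi.neg_apply, Int.cast_neg, mul_neg]
  linarith

/-- [folklore] One EVEN e.o.m. leg with zero mass: `HasSum (y ↦ (Σ'_x G(y−x)·g x)·y_κ·y_λ) (M₂^{κλ}(G)·Σ' g)`. -/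
theorem hasSum_conv_mul_coord2_of_even (G g : (Fin d → ℤ) → ℝ) (hG : AbsMoment₂ G) (hg : AbsMoment₂ g) (κ l : Fin d)
    (h0 : ∑' t, G t = 0) (heven : ∀ t, G (-t) = G t) :
    HasSum (fun y : Fin d → ℤ => (∑' x, G (y - x) * g x) * (y κ : ℝ) * (y l : ℝ))
      ((∑' t, G t * (t κ : ℝ) * (t l : ℝ)) * (∑' x, g x)) :=
  hasSum_conv_mul_coord2_of_T0T1 G g hG hg κ l h0 (tsum_mul_coord_eq_zero_of_even heven κ)
    (tsum_mul_coord_eq_zero_of_even heven l)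

/-- [folklore] `B12Beta.secondMoment` PACKAGING, scalar e.o.m. leg, `Kernel d`-valued inner kernel: the loop kernel
`k μ ν y := Σ'_x G (y − x)·g μ ν x` has `secondMoment k μ ν = M₂^{μν}(G)·Σ' g μ ν`. -/
theorem secondMoment_conv_of_T0T1 (G : (Fin d → ℤ) → ℝ) (g : B12Beta.Kernel d) (μ ν : Fin d) (hG : AbsMoment₂ G)
    (hg : AbsMoment₂ (g μ ν)) (h0 : ∑' t, G t = 0) (h1μ : ∑' t, G t * (t μ : ℝ) = 0) (h1ν : ∑' t, G t * (t ν : ℝ) = 0) :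
    B12Beta.secondMoment (fun a b y => ∑' x, G (y - x) * g a b x) μ ν
      = (∑' t, G t * (t μ : ℝ) * (t ν : ℝ)) * (∑' x, g μ ν x) := by
  unfold B12Beta.secondMoment
  exact (hasSum_conv_mul_coord2_of_T0T1 G (g μ ν) hG hg μ ν h0 h1μ h1ν).tsum_eq

/-- [folklore] DIRECTION-INDEXED e.o.m. LEG: `k μ ν y := Σ_c Σ'_x G μ c (y − x)·g c ν x` with (T0), (T1) on every block `G μ c` ⟹
`HasSum (y ↦ k μ ν y·y_μ·y_ν) (Σ_c M₂^{μν}(G μ c)·Σ' g c ν)`. -/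
theorem hasSum_mconv_mul_coord2_of_T0T1 (G g : Fin d → Fin d → (Fin d → ℤ) → ℝ) (μ ν : Fin d)
    (hG : ∀ c, AbsMoment₂ (G μ c)) (hg : ∀ c, AbsMoment₂ (g c ν)) (h0 : ∀ c, ∑' t, G μ c t = 0)
    (h1μ : ∀ c, ∑' t, G μ c t * (t μ : ℝ) = 0) (h1ν : ∀ c, ∑' t, G μ c t * (t ν : ℝ) = 0) :
    HasSum (fun y : Fin d → ℤ => (∑ c, ∑' x, G μ c (y - x) * g c ν x) * (y μ : ℝ) * (y ν : ℝ))
      (∑ c, (∑' t, G μ c t * (t μ : ℝ) * (t ν : ℝ)) * (∑' x, g c ν x)) := by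
  have e : (fun y : Fin d → ℤ => (∑ c, ∑' x, G μ c (y - x) * g c ν x) * (y μ : ℝ) * (y ν : ℝ))
      = fun y => ∑ c, (∑' x, G μ c (y - x) * g c ν x) * (y μ : ℝ) * (y ν : ℝ) := by
    funext y; rw [Finset.sum_mul, Finset.sum_mul]
  rw [e]
  exact hasSum_sum (fun c _ => hasSum_conv_mul_coord2_of_T0T1 (G μ c) (g c ν) (hG c) (hg c) μ ν (h0 c) (h1μ c) (h1ν c))

/-- [folklore] … and its `B12Beta.secondMoment` packaging: `secondMoment k μ ν = Σ_c M₂^{μν}(G μ c)·M₀(g c ν)`. -/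
theorem secondMoment_mconv_of_T0T1 (G g : Fin d → Fin d → (Fin d → ℤ) → ℝ) (μ ν : Fin d)
    (hG : ∀ c, AbsMoment₂ (G μ c)) (hg : ∀ c, AbsMoment₂ (g c ν)) (h0 : ∀ c, ∑' t, G μ c t = 0)
    (h1μ : ∀ c, ∑' t, G μ c t * (t μ : ℝ) = 0) (h1ν : ∀ c, ∑' t, G μ c t * (t ν : ℝ) = 0) :
    B12Beta.secondMoment (fun a b y => ∑ c, ∑' x, G a c (y - x) * g c b x) μ ν
      = ∑ c, (∑' t, G μ c t * (t μ : ℝ) * (t ν : ℝ)) * (∑' x, g c ν x) := by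
  unfold B12Beta.secondMoment
  exact (hasSum_mconv_mul_coord2_of_T0T1 G g μ ν hG hg h0 h1μ h1ν).tsum_eq

/-- [folklore] DISPLAYED CONSTANT (zeroth moment): `|Σ' g| ≤ Σ'_x (1 + |x|₁²)·|g x|`. -/
theorem abs_tsum_le_absMoment₂ {g : (Fin d → ℤ) → ℝ} (hg : AbsMoment₂ g) :
    |∑' x, g x| ≤ ∑' x, (1 + l1 x ^ 2) * |g x| := by
  have hs : Summable (fun x => ‖g x‖) := (summable_of_absMoment₂ hg).norm
  calc |∑' x, g x| = ‖∑' x, g x‖ := (Real.norm_eq_abs _).symm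
    _ ≤ ∑' x, ‖g x‖ := norm_tsum_le_tsum_norm hs
    _ ≤ ∑' x, (1 + l1 x ^ 2) * |g x| := by
        refine hs.tsum_le_tsum (fun x => ?_) hg
        rw [Real.norm_eq_abs]
        have := abs_nonneg (g x)
        nlinarith [sq_nonneg (l1 x)]

/-- [folklore] DISPLAYED CONSTANT (second moment): `|Σ'_t G t·t_κ·t_λ| ≤ Σ'_t (1 + |t|₁²)·|G t|`. -/
theorem abs_tsum_mul_coord2_le_absMoment₂ {G : (Fin d → ℤ) → ℝ} (hG : AbsMoment₂ G) (κ l : Fin d) :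
    |∑' t, G t * (t κ : ℝ) * (t l : ℝ)| ≤ ∑' t, (1 + l1 t ^ 2) * |G t| := by
  have hpt : ∀ t : Fin d → ℤ, ‖G t * (t κ : ℝ) * (t l : ℝ)‖ ≤ (1 + l1 t ^ 2) * |G t| := fun t => by
    rw [Real.norm_eq_abs, mul_assoc, abs_mul, mul_comm]
    refine mul_le_mul_of_nonneg_right ?_ (abs_nonneg _)
    have h := abs_le_of_isMoment₂ (IsMoment₂.coord2 κ l) t
    simpa only [Int.cast_mul] using h
  have hs : Summable (fun t : Fin d → ℤ => ‖G t * (t κ : ℝ) * (t l : ℝ)‖) :=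
    Summable.of_nonneg_of_le (fun _ => norm_nonneg _) hpt hG
  calc |∑' t, G t * (t κ : ℝ) * (t l : ℝ)| = ‖∑' t, G t * (t κ : ℝ) * (t l : ℝ)‖ := (Real.norm_eq_abs _).symm
    _ ≤ ∑' t, ‖G t * (t κ : ℝ) * (t l : ℝ)‖ := norm_tsum_le_tsum_norm hs
    _ ≤ ∑' t, (1 + l1 t ^ 2) * |G t| := hs.tsum_le_tsum hpt hG

/-- [folklore] **THE DISPLAYED n-FREE CONSTANT OF ROW RHOA-7**: with one e.o.m. leg ((T0), (T1)) the loop kernel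
`k μ ν y := Σ'_x G (y − x)·g μ ν x` has `|secondMoment k μ ν| ≤ (Σ'_t (1+|t|₁²)|G t|)·(Σ'_x (1+|x|₁²)|g μ ν x|)` — finite, and uniform in
any parameter in which the two `AbsMoment₂` letters are. -/
theorem abs_secondMoment_conv_le_of_T0T1 (G : (Fin d → ℤ) → ℝ) (g : B12Beta.Kernel d) (μ ν : Fin d) (hG : AbsMoment₂ G)
    (hg : AbsMoment₂ (g μ ν)) (h0 : ∑' t, G t = 0) (h1μ : ∑' t, G t * (t μ : ℝ) = 0) (h1ν : ∑' t, G t * (t ν : ℝ) = 0) :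
    |B12Beta.secondMoment (fun a b y => ∑' x, G (y - x) * g a b x) μ ν|
      ≤ (∑' t, (1 + l1 t ^ 2) * |G t|) * (∑' x, (1 + l1 x ^ 2) * |g μ ν x|) := by
  rw [secondMoment_conv_of_T0T1 G g μ ν hG hg h0 h1μ h1ν, abs_mul]
  exact mul_le_mul (abs_tsum_mul_coord2_le_absMoment₂ hG μ ν) (abs_tsum_le_absMoment₂ hg) (abs_nonneg _)
    (tsum_nonneg (fun t => mul_nonneg (by positivity) (abs_nonneg _)))

/-- [folklore] LOCATED REMARK «(1.22) uses `μ ≠ ν`»: a SCALAR leg that is even under the reflection of the single coordinate `κ`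
(`G (t with t_κ ↦ −t_κ) = G t`) has `Σ'_t G t·t_κ·t_λ = 0` for every `λ ≠ κ` (the summand is odd under that involution; no summability
needed). -/
theorem tsum_mul_coord2_eq_zero_of_reflect {G : (Fin d → ℤ) → ℝ} {κ l : Fin d} (hκl : κ ≠ l)
    (hrefl : ∀ t : Fin d → ℤ, G (Function.update t κ (-t κ)) = G t) :
    ∑' t, G t * (t κ : ℝ) * (t l : ℝ) = 0 := by
  set r : (Fin d → ℤ) → (Fin d → ℤ) := fun t => Function.update t κ (-t κ) with hr
  have hrκ : ∀ t, r t κ = -t κ := fun t => by simp [hr]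
  have hrl : ∀ t, r t l = t l := fun t => by simp [hr, Function.update_of_ne hκl.symm]
  have hinv : Function.Involutive r := fun t => by
    funext i
    by_cases hi : i = κ
    · subst hi; rw [hrκ, hrκ, neg_neg]
    · simp [hr, Function.update_of_ne hi]
  let e : (Fin d → ℤ) ≃ (Fin d → ℤ) := hinv.toPerm r
  have h1 : ∑' t, G (e t) * ((e t) κ : ℝ) * ((e t) l : ℝ) = ∑' t, G t * (t κ : ℝ) * (t l : ℝ) :=
    Equiv.tsum_eq e (fun t => G t * (t κ : ℝ) * (t l : ℝ))
  have h2 : ∑' t, G (e t) * ((e t) κ : ℝ) * ((e t) l : ℝ) = -∑' t, G t * (t κ : ℝ) * (t l : ℝ) := by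
    rw [← tsum_neg]
    refine tsum_congr (fun t => ?_)
    show G (r t) * ((r t) κ : ℝ) * ((r t) l : ℝ) = _
    rw [hrefl t, hrκ, hrl, Int.cast_neg]
    ring
  linarith

/-- [folklore] … hence with such a leg (and (T0), (T1)) the OFF-DIAGONAL second moments of the loop kernel `y ↦ Σ'_x G(y−x)·g μ ν x` VANISH:
`secondMoment k μ ν = 0` for `μ ≠ ν` — the loop contributes nothing to the `μ ≠ ν` moments that (1.22) uses.  (Scalar legs only; for a
direction-indexed leg the mixed blocks survive, `secondMoment_mconv_of_T0T1`.) -/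
theorem secondMoment_conv_eq_zero_of_reflect (G : (Fin d → ℤ) → ℝ) (g : B12Beta.Kernel d) {μ ν : Fin d} (hμν : μ ≠ ν)
    (hG : AbsMoment₂ G) (hg : AbsMoment₂ (g μ ν)) (h0 : ∑' t, G t = 0) (h1μ : ∑' t, G t * (t μ : ℝ) = 0)
    (h1ν : ∑' t, G t * (t ν : ℝ) = 0) (hrefl : ∀ t : Fin d → ℤ, G (Function.update t μ (-t μ)) = G t) :
    B12Beta.secondMoment (fun a b y => ∑' x, G (y - x) * g a b x) μ ν = 0 := by
  rw [secondMoment_conv_of_T0T1 G g μ ν hG hg h0 h1μ h1ν, tsum_mul_coord2_eq_zero_of_reflect hμν hrefl, zero_mul]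

/-! ## §4 Two e.o.m. legs: the second moment vanishes -/

/-- [folklore] **TWO e.o.m. LEGS ⟹ ZERO SECOND MOMENT**: for the two-sided composition `dressedSum w T w'` with (T0) on both outer factors
(`Σ' w = 0 = Σ' w'`) and (T1) on `w` in the two coordinates `κ, λ`, `HasSum (y ↦ dressedSum w T w' y·y_κ·y_λ) 0` — every one of the nine
terms carries a factor `σ`, `C_κ`, `C_λ` or `σ′`. -/
theorem hasSum_dressedSum_mul_coord2_eq_zero (w T w' : (Fin d → ℤ) → ℝ) (hw : AbsMoment₂ w) (hT : AbsMoment₂ T)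
    (hw' : AbsMoment₂ w') (κ l : Fin d) (hw0 : ∑' u, w u = 0) (hw1κ : ∑' u, w u * (u κ : ℝ) = 0)
    (hw1l : ∑' u, w u * (u l : ℝ) = 0) (hw'0 : ∑' x, w' x = 0) :
    HasSum (fun y : Fin d → ℤ => dressedSum w T w' y * (y κ : ℝ) * (y l : ℝ)) 0 := by
  have h := hasSum_dressedSum_mul_coord2 w T w' hw hT hw' κ l
  rw [hw0, hw1κ, hw1l, hw'0] at h
  simpa only [zero_mul, mul_zero, add_zero, sub_zero] using h

/-- [folklore] The mirror variant: (T0) on both outer factors and (T1) on `w'` (coordinates `κ, λ`) ⟹ zero second moment. -/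
theorem hasSum_dressedSum_mul_coord2_eq_zero' (w T w' : (Fin d → ℤ) → ℝ) (hw : AbsMoment₂ w) (hT : AbsMoment₂ T)
    (hw' : AbsMoment₂ w') (κ l : Fin d) (hw0 : ∑' u, w u = 0) (hw'0 : ∑' x, w' x = 0)
    (hw'1κ : ∑' x, w' x * (x κ : ℝ) = 0) (hw'1l : ∑' x, w' x * (x l : ℝ) = 0) :
    HasSum (fun y : Fin d → ℤ => dressedSum w T w' y * (y κ : ℝ) * (y l : ℝ)) 0 := by
  have h := hasSum_dressedSum_mul_coord2 w T w' hw hT hw' κ l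
  rw [hw0, hw'0, hw'1κ, hw'1l] at h
  simpa only [zero_mul, mul_zero, add_zero, sub_zero] using h

/-- [folklore] `B12Beta.secondMoment` packaging of §4: a loop kernel `k μ ν := dressedSum w (T μ ν) w'` with the e.o.m. letters (T0) on `w, w'`
and (T1) on `w` has `secondMoment k μ ν = 0` — it cannot touch the slope at all. -/
theorem secondMoment_dressedSum_eq_zero (w w' : (Fin d → ℤ) → ℝ) (T : B12Beta.Kernel d) (μ ν : Fin d) (hw : AbsMoment₂ w)
    (hT : AbsMoment₂ (T μ ν)) (hw' : AbsMoment₂ w') (hw0 : ∑' u, w u = 0) (hw1μ : ∑' u, w u * (u μ : ℝ) = 0)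
    (hw1ν : ∑' u, w u * (u ν : ℝ) = 0) (hw'0 : ∑' x, w' x = 0) :
    B12Beta.secondMoment (fun a b y => dressedSum w (T a b) w' y) μ ν = 0 := by
  unfold B12Beta.secondMoment
  exact (hasSum_dressedSum_mul_coord2_eq_zero w (T μ ν) w' hw hT hw' μ ν hw0 hw1μ hw1ν hw'0).tsum_eq

/-! ## §5 Addendum v1.1 (append-only): the displayed constant for the direction-indexed leg -/

/-- [folklore] **DISPLAYED n-FREE CONSTANT, DIRECTION-INDEXED e.o.m. LEG** (the «resp. `Σ_c` of it» announced in the INTENT): with (T0), (T1) on every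
block `G μ c`, the loop kernel `k μ ν y := Σ_c Σ'_x G μ c (y − x)·g c ν x` has
`|secondMoment k μ ν| ≤ Σ_c (Σ'_t (1+|t|₁²)|G μ c t|)·(Σ'_x (1+|x|₁²)|g c ν x|)`. -/
theorem abs_secondMoment_mconv_le_of_T0T1 (G g : Fin d → Fin d → (Fin d → ℤ) → ℝ) (μ ν : Fin d)
    (hG : ∀ c, AbsMoment₂ (G μ c)) (hg : ∀ c, AbsMoment₂ (g c ν)) (h0 : ∀ c, ∑' t, G μ c t = 0)
    (h1μ : ∀ c, ∑' t, G μ c t * (t μ : ℝ) = 0) (h1ν : ∀ c, ∑' t, G μ c t * (t ν : ℝ) = 0) :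
    |B12Beta.secondMoment (fun a b y => ∑ c, ∑' x, G a c (y - x) * g c b x) μ ν|
      ≤ ∑ c, (∑' t, (1 + l1 t ^ 2) * |G μ c t|) * (∑' x, (1 + l1 x ^ 2) * |g c ν x|) := by
  rw [secondMoment_mconv_of_T0T1 G g μ ν hG hg h0 h1μ h1ν]
  refine (Finset.abs_sum_le_sum_abs _ _).trans (Finset.sum_le_sum (fun c _ => ?_))
  rw [abs_mul]
  exact mul_le_mul (abs_tsum_mul_coord2_le_absMoment₂ (hG c) μ ν) (abs_tsum_le_absMoment₂ (hg c)) (abs_nonneg _)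
    (tsum_nonneg (fun t => mul_nonneg (by positivity) (abs_nonneg _)))

end Summit.QuantumFields.BalabanUV.Beta.FP.MultiplierVertexMoment

end
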